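import Literature.Probability.LatticeModels.IsingGibbsMixture
import Literature.Probability.LatticeModels.LebowitzPropagation
import Literature.Probability.LatticeModels.GibbsEnergyBounds
import HarnessLib

/-!
# Lebowitz 1977: translation invariant Gibbs states of the Ising model are mixtures of `μ⁺` and `μ⁻` wherever the nearest-neighbour energies of `μ^∅` and `μ⁺` agree

Topic `Probability/LatticeModels`, namespace `Literature.Probability.LatticeModels`. Theorem-only file
(no definitions, no named facts): the assembly of J. L. Lebowitz, *Coexistence of phases in Ising
ferromagnets*, J. Stat. Phys. **16** (1977) 463–476, Theorems 2–3 and Remark (iii), p. 472, for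
the nearest-neighbour Ising model on `ℤ^d` at zero field, from the tree's proved ingredients
(`GibbsEnergyBounds`, `LebowitzPropagation`, `IsingGibbsMixture`, and Step A/C of
`SharpnessLROProofs`):

* `sum_freeCorr_nn_le_sum_spinCorr_nn_of_isTranslationInvariant` — for a translation invariant
  `μ ∈ 𝒢(β,0)`, `β > 0`: `∑ᵢ ⟨σ_0σ_{eᵢ}⟩^∅_β ≤ ∑ᵢ ⟨σ_0σ_{eᵢ}⟩_μ` (the energy of `μ` is at least the
  left derivative of the pressure, `GibbsEnergyBounds`, and `β ↦ ⟨σ_A⟩^∅_β` is lower semicontinuous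
  from the left, being a supremum of continuous finite-volume correlations — ADS15 §3.3 /
  Friedli–Velenik 2017, Exercise 3.16 with Lemma 3.31).
* `nn_spinCorr_eq_plusCorr_of_isTranslationInvariant` — **Lebowitz 1977, Thm. 2 (first part) for
  an arbitrary translation invariant state**: if `⟨σ_0σ_{eᵢ}⟩^∅_β = ⟨σ_0σ_{eᵢ}⟩⁺_β` for every
  direction `i` (i.e. `ψ` is differentiable in `β` at `β`), then every translation invariant
  `μ ∈ 𝒢(β,0)` has `⟨σ_xσ_{x+eᵢ}⟩_μ = ⟨σ_xσ_{x+eᵢ}⟩⁺_β` (upper bound by domination, lower bound on the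
  sum by the previous item).
* `translationInvariant_eq_mixture_of_nn_freeCorr_eq_plusCorr` — **Lebowitz 1977, Thm. 3 with
  Remark (iii), p. 472, at a given `β`**: if moreover `m*(β) > 0`, every translation invariant
  `μ ∈ 𝒢(β,0)` is `t μ⁺ + (1-t) μ⁻`, `t ∈ [0,1]` (propagation to all even correlations,
  `LebowitzPropagation`, then `IsingGibbsMixture`).
* `bodineau_translationInvariant_of_nn_freeCorr_eq_plusCorr` — hence **the named fact
  `bodineau_translationInvariant` (Bodineau, PTRF 135 (2006) 153–168) at `(d, β)` follows from the
  single identity `⟨σ_0σ_{eᵢ}⟩^∅_β = ⟨σ_0σ_{eᵢ}⟩⁺_β`, `i = 1,…,d`** — Bodineau's Theorem 2.1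
  (`Φ^f_β(0↔∞) = Φ^w_β(0↔∞)` for `β ≠ β_c`, whence uniqueness of the FK-Ising measure and equality
  of the free and wired nearest-neighbour energies) in spin language; equivalently Raoufi, Ann.
  Probab. 48 (2020), Prop. 1. That identity for every `β > β_c(d)`, `d ≥ 3`, is the deep input
  which is not in the tree.
* `translationInvariant_eq_mixture_of_continuousAt` and
  `countable_setOf_not_translationInvariant_eq_mixture` — **Lebowitz 1977, Thm. 3 as printed
  ("the set of `β` at which there are more than two extremal translation invariant states has
  measure zero"; Remark (i): it is countable)**: for `d ≥ 2`, at every `β > β_c(d)` where the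
  plus energy `β ↦ ∑ᵢ ⟨σ_0σ_{eᵢ}⟩⁺_β` is continuous — all but countably many — every translation
  invariant Gibbs state is a mixture of `μ⁺` and `μ⁻`.

## Mathlib status

No Gibbs measures in Mathlib. Anchors: `Monotone.countable_not_continuousAt`,
`Filter.Eventually`, `nhdsWithin`, `Finset.sum_eq_zero_iff_of_nonneg`; tree: the files above and
`hasBoxLimit_isingCorr_free_holds`, `isingCorr_free_box_le_freeCorr`, `continuous_isingCorr_beta`,
`freeCorr_le_plusCorr`, `plusCorr_mono_params`, `sum_plusCorr_nn_le_sum_freeCorr_nn`,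
`criticalBeta_pos_holds`, `spontaneousMagnetization_pos_of_criticalBeta_lt_holds`.

## References

* J. L. Lebowitz, *Coexistence of phases in Ising ferromagnets*, J. Stat. Phys. 16 (1977)
  463–476, §3, Thms. 2–3, Remarks (i)–(iii), pp. 470–472.
* T. Bodineau, *Translation invariant Gibbs states for the Ising model*, Probab. Theory Related
  Fields 135 (2006) 153–168, Thm. 2.1 and §2.3.
* A. Raoufi, *Translation-invariant Gibbs states of the Ising model: general setting*, Ann.
  Probab. 48 (2020) 760–777 (arXiv:1710.07608), Thm. 1 and Prop. 1.
* S. Friedli, Y. Velenik, *Statistical Mechanics of Lattice Systems*, CUP (2017), §3.10.8,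
  Exercise 3.16, Lemma 3.31.
* M. Aizenman, H. Duminil-Copin, V. Sidoravicius, Comm. Math. Phys. 334 (2015) 719–742, §3.3.
-/

noncomputable section

open MeasureTheory Filter Topology Finset
open scoped ENNReal

namespace Literature.Probability.LatticeModels

variable {d : ℕ}

/-! ### Lower semicontinuity of the free correlations from the left -/

/-- **`β ↦ ⟨σ_A⟩^∅_{β,0}` is lower semicontinuous from the left at every `β > 0`** (ADS15, §3.3,
eq. (3.18): "`⟨σ_xσ_y⟩⁰_{Λ_L,β}` are … increasing in `L`; standard semicontinuity arguments";
Friedli–Velenik 2017, Exercise 3.16 with the argument of Lemma 3.31): `⟨σ_A⟩^∅_β` is the limit of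
the nondecreasing finite-volume free correlations, each continuous in `β`, so for every `ε > 0`,
`⟨σ_A⟩^∅_{β'} > ⟨σ_A⟩^∅_β - ε` for all `β' < β` close to `β`. [cite: AizenmanDuminilCopinSidoraviciusCMP2015, §3.3, arXiv v3 eq. (3.18)] -/
theorem eventually_lt_freeCorr_of_lt {β : ℝ} (hβ : 0 < β) (A : Finset (Site d)) {ε : ℝ} (hε : 0 < ε) :
    ∀ᶠ β' in 𝓝[<] β, freeCorr d β 0 A - ε < freeCorr d β' 0 A := by
  obtain ⟨L₀, hL₀⟩ := exists_forall_subset_box d A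
  have hconv := hasBoxLimit_isingCorr_free_holds (d := d) hβ.le le_rfl A
  have hev : ∀ᶠ L : ℕ in atTop, L₀ ≤ L ∧
      freeCorr d β 0 A - ε / 2 < isingCorr (zdGraph d) (box d L) β 0 .free A :=
    (eventually_ge_atTop L₀).and (hconv.eventually (lt_mem_nhds (by linarith)))
  obtain ⟨L, hLL₀, hL⟩ := hev.exists
  have hcont := (continuous_isingCorr_beta (zdGraph d) (box d L) 0 .free A).continuousAt (x := β)
  have hnear : ∀ᶠ β' in 𝓝 β, isingCorr (zdGraph d) (box d L) β 0 .free A - ε / 2 <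
      isingCorr (zdGraph d) (box d L) β' 0 .free A :=
    hcont.eventually (lt_mem_nhds (by linarith))
  filter_upwards [nhdsWithin_le_nhds hnear, Ioo_mem_nhdsLT hβ] with β' hβ' hβ'I
  have hge : isingCorr (zdGraph d) (box d L) β' 0 .free A ≤ freeCorr d β' 0 A :=
    isingCorr_free_box_le_freeCorr hβ'I.1.le le_rfl (hL₀ L hLL₀)
  linarith

/-- **The free nearest-neighbour energy at `β` bounds the energy of every translation invariant
Gibbs state at `β` from below** (Lebowitz 1977, §3, proof of Thm. 2, p. 470: `∂Ψ(β-0)/∂β ≤`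
energy of every `μ ∈ T`; here `∂⁻ψ(β) = ∑ᵢ ⟨σ_0σ_{eᵢ}⟩^∅_β`): for `β > 0` and a translation invariant
`μ ∈ 𝒢(β,0)`, `∑ᵢ ⟨σ_0σ_{eᵢ}⟩^∅_β ≤ ∑ᵢ ⟨σ_0σ_{eᵢ}⟩_μ`. Proof: for `0 ≤ β' < β`,
`∑ᵢ ⟨σ_0σ_{eᵢ}⟩^∅_{β'} ≤ ∑ᵢ ⟨σ_0σ_{eᵢ}⟩⁺_{β'} ≤ ∑ᵢ ⟨σ_0σ_{eᵢ}⟩_μ` (`GibbsEnergyBounds`), and the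
left side is lower semicontinuous from the left in `β'`. [cite: Lebowitz1977, §3, proof of Thm. 2, p. 470] -/
theorem sum_freeCorr_nn_le_sum_spinCorr_nn_of_isTranslationInvariant {β : ℝ} (hβ : 0 < β)
    {μ : Measure (SpinConfig (Site d))} (hμG : μ ∈ isingGibbsMeasures d β 0)
    (hμT : IsTranslationInvariantMeasure μ) :
    ∑ i, freeCorr d β 0 {0, Pi.single i 1} ≤ ∑ i, spinCorr μ {0, Pi.single i 1} := by
  refine le_of_forall_pos_lt_add fun ε hε => ?_
  have hε' : 0 < ε / (d + 1) := by positivity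
  have hall : ∀ᶠ β' in 𝓝[<] β, ∀ i : Fin d,
      freeCorr d β 0 {0, Pi.single i 1} - ε / (d + 1) < freeCorr d β' 0 {0, Pi.single i 1} :=
    eventually_all.2 fun i => eventually_lt_freeCorr_of_lt hβ {0, Pi.single i 1} hε'
  obtain ⟨β', ⟨hfree, hβ'I⟩⟩ := (hall.and (Ioo_mem_nhdsLT hβ)).exists
  have hβ'0 : 0 ≤ β' := hβ'I.1.le
  have h1 : ∑ i, freeCorr d β' 0 {0, Pi.single i 1} ≤ ∑ i, spinCorr μ {0, Pi.single i 1} :=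
    (Finset.sum_le_sum fun i _ => freeCorr_le_plusCorr hβ'0 le_rfl _).trans
      (sum_plusCorr_nn_le_sum_spinCorr_nn_of_isTranslationInvariant hβ'0 hβ'I.2 hμG hμT)
  have h2 : ∑ i, freeCorr d β 0 {0, Pi.single i 1} - d * (ε / (d + 1)) ≤
      ∑ i, freeCorr d β' 0 {0, Pi.single i 1} := by
    calc ∑ i, freeCorr d β 0 {0, Pi.single i 1} - d * (ε / (d + 1))
        = ∑ i : Fin d, (freeCorr d β 0 {0, Pi.single i 1} - ε / (d + 1)) := by
          rw [Finset.sum_sub_distrib, Finset.sum_const, Finset.card_univ, Fintype.card_fin, nsmul_eq_mul]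
      _ ≤ ∑ i, freeCorr d β' 0 {0, Pi.single i 1} := Finset.sum_le_sum fun i _ => (hfree i).le
  have h3 : (d : ℝ) * (ε / (d + 1)) < ε := by
    rw [mul_div_assoc', div_lt_iff₀ (by positivity)]
    nlinarith
  linarith

/-! ### Lebowitz 1977, Theorem 2 (first part) for an arbitrary translation invariant state -/

/-- **Lebowitz 1977, Thm. 2 (first part), for an arbitrary translation invariant Gibbs state**
(§3, p. 470: at a `β` where `∂Ψ/∂β` is continuous, "`⟨σ_K⟩₊ = ⟨σ_K⟩_μ` for all `μ ∈ T`" for the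
nearest-neighbour sets `K = {0, e_α}`): for the nearest-neighbour Ising model on `ℤ^d` at `β > 0`,
if the nearest-neighbour energies of the free and plus states agree,
`⟨σ_0σ_{eᵢ}⟩^∅_β = ⟨σ_0σ_{eᵢ}⟩⁺_β` for all `i` (equivalently, the pressure is differentiable in `β`
at `β`), then every translation invariant `μ ∈ 𝒢(β,0)` has the plus nearest-neighbour energies,
`⟨σ_xσ_{x+eᵢ}⟩_μ = ⟨σ_xσ_{x+eᵢ}⟩⁺_β` for all `x`, `i`: the terms are `≤` by domination
(`spinCorr_le_plusCorr_of_isGibbsMeasure`) and the sums are `≥`. [cite: Lebowitz1977, §3, Thm. 2 (proof), p. 470] -/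
theorem nn_spinCorr_eq_plusCorr_of_isTranslationInvariant {β : ℝ} (hβ : 0 < β)
    (hfp : ∀ i : Fin d, freeCorr d β 0 {0, Pi.single i 1} = plusCorr d β 0 {0, Pi.single i 1})
    {μ : Measure (SpinConfig (Site d))} (hμG : μ ∈ isingGibbsMeasures d β 0)
    (hμT : IsTranslationInvariantMeasure μ) (x : Site d) (i : Fin d) :
    spinCorr μ {x, x + Pi.single i 1} = plusCorr d β 0 {x, x + Pi.single i 1} := by
  rw [spinCorr_pair_shift_of_isTranslationInvariant hμT, plusCorr_pair_shift hβ.le]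
  have hterm : ∀ j ∈ (univ : Finset (Fin d)),
      0 ≤ plusCorr d β 0 {0, Pi.single j 1} - spinCorr μ {0, Pi.single j 1} := fun j _ =>
    sub_nonneg.2 (spinCorr_le_plusCorr_of_isGibbsMeasure hβ.le le_rfl hμG _)
  have hsum : ∑ j, plusCorr d β 0 {0, Pi.single j 1} ≤ ∑ j, spinCorr μ {0, Pi.single j 1} := by
    calc ∑ j, plusCorr d β 0 {0, Pi.single j 1} = ∑ j, freeCorr d β 0 {0, Pi.single j 1} :=
          Finset.sum_congr rfl fun j _ => (hfp j).symm
      _ ≤ ∑ j, spinCorr μ {0, Pi.single j 1} :=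
          sum_freeCorr_nn_le_sum_spinCorr_nn_of_isTranslationInvariant hβ hμG hμT
  have hsum0 : ∑ j, (plusCorr d β 0 {0, Pi.single j 1} - spinCorr μ {0, Pi.single j 1}) = 0 := by
    apply le_antisymm
    · rw [Finset.sum_sub_distrib]
      linarith
    · exact Finset.sum_nonneg hterm
  have := (Finset.sum_eq_zero_iff_of_nonneg hterm).1 hsum0 i (mem_univ i)
  linarith

/-! ### Lebowitz 1977, Theorem 3 / Remark (iii): translation invariant states are mixtures -/

/-- **Lebowitz 1977, Thm. 3 with Remark (iii), p. 472, at a given `β` (all ingredients proved):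
translation invariant Gibbs states are mixtures of the pure phases.** For the nearest-neighbour
Ising model on `ℤ^d` at zero field and `β > 0` with `m*(β) > 0`, if
`⟨σ_0σ_{eᵢ}⟩^∅_β = ⟨σ_0σ_{eᵢ}⟩⁺_β` for every direction `i`, then every translation invariant
`μ ∈ 𝒢(β,0)` is `t μ⁺ + (1-t) μ⁻` for some `t ∈ [0,1]`, where `μ⁺, μ⁻ ∈ 𝒢(β,0)` are the plus and
minus states (correlations `plusCorr d β 0`, `minusCorr d β 0`). Proof: the nearest-neighbour pair
correlations of `μ` are those of `μ⁺` (`nn_spinCorr_eq_plusCorr_of_isTranslationInvariant`), hence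
all even correlations are (Lebowitz' propagation, `spinCorr_eq_plusCorr_of_even`), hence `μ` is a
mixture (`exists_eq_mixture_of_even_spinCorr_eq_plusCorr`). [cite: Lebowitz1977, §3, Thm. 3 and Remark (iii), p. 472] -/
theorem translationInvariant_eq_mixture_of_nn_freeCorr_eq_plusCorr {β : ℝ} (hβ : 0 < β)
    (hm : 0 < spontaneousMagnetization d β)
    (hfp : ∀ i : Fin d, freeCorr d β 0 {0, Pi.single i 1} = plusCorr d β 0 {0, Pi.single i 1})
    {μ : Measure (SpinConfig (Site d))} (hμG : μ ∈ isingGibbsMeasures d β 0)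
    (hμT : IsTranslationInvariantMeasure μ) :
    ∃ μp μm : Measure (SpinConfig (Site d)),
      μp ∈ isingGibbsMeasures d β 0 ∧ μm ∈ isingGibbsMeasures d β 0 ∧
        (∀ A, spinCorr μp A = plusCorr d β 0 A) ∧ (∀ A, spinCorr μm A = minusCorr d β 0 A) ∧
          ∃ t : ℝ≥0∞, t ≤ 1 ∧ μ = t • μp + (1 - t) • μm :=
  exists_eq_mixture_of_even_spinCorr_eq_plusCorr hβ.le hμG
    (spinCorr_eq_plusCorr_of_even hβ.le hm hμG
      (nn_spinCorr_eq_plusCorr_of_isTranslationInvariant hβ hfp hμG hμT))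

/-- **Reduction of Bodineau's theorem to the equality of the free and plus nearest-neighbour
energies.** The named fact `bodineau_translationInvariant` (`GibbsStates.lean`; T. Bodineau,
PTRF 135 (2006) 153–168: for `d ≥ 3` and `β > β_c(d)` every translation invariant `μ ∈ 𝒢(β,0)`
is a mixture of `μ⁺` and `μ⁻`) holds at `(d, β)` as soon as
`⟨σ_0σ_{eᵢ}⟩^∅_{β,0} = ⟨σ_0σ_{eᵢ}⟩⁺_{β,0}` for every direction `i`. This identity is, in spin
language, the consequence "uniqueness of the FK-Ising measure for `β ≠ β_c`" of Bodineau's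
Theorem 2.1 (`Φ^f_β(0↔∞) = Φ^w_β(0↔∞)`, §2.3 of the paper, via Grimmett 1995, Thm. 5.3), or
Raoufi, Ann. Probab. 48 (2020), Prop. 1 (`⟨σ_xσ_y⟩⁺_β = ⟨σ_xσ_y⟩⁰_β` for `J_{xy} > 0`, all `β`) —
the one remaining deep input, not proved in the tree; everything else (Lebowitz 1977, Thms. 2–3,
Remark (iii)) is proved here. (`β > β_c(d) > 0` and `m*(β) > 0` by Peierls' estimate,
`criticalBeta_pos_holds`, `spontaneousMagnetization_pos_of_criticalBeta_lt_holds`.) [cite: Bodineau2006, Thm. 2.1 and §2.3] -/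
theorem bodineau_translationInvariant_of_nn_freeCorr_eq_plusCorr {β : ℝ}
    (hfp : ∀ i : Fin d, freeCorr d β 0 {0, Pi.single i 1} = plusCorr d β 0 {0, Pi.single i 1}) :
    bodineau_translationInvariant (d := d) (β := β) := by
  intro hd hβc μ hμ hμT
  have hd2 : 2 ≤ d := le_trans (by norm_num) hd
  have hβ : 0 < β := (criticalBeta_pos_holds hd2).trans hβc
  have hm : 0 < spontaneousMagnetization d β := spontaneousMagnetization_pos_of_criticalBeta_lt_holds hd2 hβc
  obtain ⟨μp, μm, hμp, hμm, hp, hmc, t, ht, hμeq⟩ :=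
    translationInvariant_eq_mixture_of_nn_freeCorr_eq_plusCorr hβ hm hfp hμ hμT
  exact ⟨μp, μm, hμp, hμm, hp, hmc, t, ht, hμeq⟩

/-! ### Lebowitz 1977, Theorem 3 as printed: mixtures off a countable set of `β` -/

/-- **At a continuity point of the plus energy, the free and plus nearest-neighbour energies
agree** (Lebowitz 1977, §3, Thm. 2 with Remark (i), pp. 470–471; the argument of the tree's
`exists_nn_freeCorr_eq_plusCorr`): if `β > 0` and `b ↦ ∑ᵢ ⟨σ_0σ_{eᵢ}⟩⁺_{max b 0}` is continuous at
`β`, then `⟨σ_0σ_{eᵢ}⟩^∅_β = ⟨σ_0σ_{eᵢ}⟩⁺_β` for all `i` (Step A: `∑ᵢ ⟨σ_0σ_{eᵢ}⟩⁺_{β'} ≤ ∑ᵢ ⟨σ_0σ_{eᵢ}⟩^∅_β`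
for `β' < β`, and `⟨·⟩^∅ ≤ ⟨·⟩⁺` termwise). [cite: Lebowitz1977, §3, Thm. 2 and Remark (i), pp. 470–471] -/
theorem nn_freeCorr_eq_plusCorr_of_continuousAt {β : ℝ} (hβ : 0 < β)
    (hcont : ContinuousAt (fun b : ℝ => ∑ i : Fin d, plusCorr d (max b 0) 0 {0, Pi.single i 1}) β) :
    ∀ i : Fin d, freeCorr d β 0 {0, Pi.single i 1} = plusCorr d β 0 {0, Pi.single i 1} := by
  set Pt : ℝ → ℝ := fun b => ∑ i : Fin d, plusCorr d (max b 0) 0 {0, Pi.single i 1} with hPt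
  have hle : Pt β ≤ ∑ i, freeCorr d β 0 {0, Pi.single i 1} := by
    have hev : ∀ᶠ β' in 𝓝[<] β, Pt β' ≤ ∑ i, freeCorr d β 0 {0, Pi.single i 1} := by
      filter_upwards [Ioo_mem_nhdsLT hβ] with β' hβ'
      have hβ'0 : 0 ≤ β' := hβ'.1.le
      simp only [hPt, max_eq_left hβ'0]
      exact sum_plusCorr_nn_le_sum_freeCorr_nn hβ'0 hβ'.2
    exact le_of_tendsto (hcont.tendsto.mono_left nhdsWithin_le_nhds) hev
  have hPβ : Pt β = ∑ i, plusCorr d β 0 {0, Pi.single i 1} := by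
    simp only [hPt, max_eq_left hβ.le]
  rw [hPβ] at hle
  have hterm : ∀ i ∈ (univ : Finset (Fin d)),
      0 ≤ plusCorr d β 0 {0, Pi.single i 1} - freeCorr d β 0 {0, Pi.single i 1} :=
    fun i _ => sub_nonneg.2 (freeCorr_le_plusCorr hβ.le le_rfl _)
  have hsum0 : ∑ i, (plusCorr d β 0 {0, Pi.single i 1} - freeCorr d β 0 {0, Pi.single i 1}) = 0 := by
    apply le_antisymm
    · rw [Finset.sum_sub_distrib]
      linarith
    · exact Finset.sum_nonneg hterm
  intro i
  have := (Finset.sum_eq_zero_iff_of_nonneg hterm).1 hsum0 i (mem_univ i)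
  linarith

/-- **Lebowitz 1977, Thm. 3, proved: at every continuity point `β > β_c(d)` of the plus energy,
the translation invariant Gibbs states are the mixtures of `μ⁺` and `μ⁻`** (§3, Thm. 3 and Remark
(iii), p. 472, with Thm. 2 and Remark (i); `d ≥ 2` so that `β_c(d) > 0` and `m*(β) > 0` for
`β > β_c(d)` by Peierls' estimate). [cite: Lebowitz1977, §3, Thm. 3 and Remark (iii), p. 472] -/
theorem translationInvariant_eq_mixture_of_continuousAt (hd : 2 ≤ d) {β : ℝ} (hβc : criticalBeta d < β)
    (hcont : ContinuousAt (fun b : ℝ => ∑ i : Fin d, plusCorr d (max b 0) 0 {0, Pi.single i 1}) β)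
    {μ : Measure (SpinConfig (Site d))} (hμG : μ ∈ isingGibbsMeasures d β 0)
    (hμT : IsTranslationInvariantMeasure μ) :
    ∃ μp μm : Measure (SpinConfig (Site d)),
      μp ∈ isingGibbsMeasures d β 0 ∧ μm ∈ isingGibbsMeasures d β 0 ∧
        (∀ A, spinCorr μp A = plusCorr d β 0 A) ∧ (∀ A, spinCorr μm A = minusCorr d β 0 A) ∧
          ∃ t : ℝ≥0∞, t ≤ 1 ∧ μ = t • μp + (1 - t) • μm := by
  have hβ : 0 < β := (criticalBeta_pos_holds hd).trans hβc
  exact translationInvariant_eq_mixture_of_nn_freeCorr_eq_plusCorr hβ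
    (spontaneousMagnetization_pos_of_criticalBeta_lt_holds hd hβc)
    (nn_freeCorr_eq_plusCorr_of_continuousAt hβ hcont) hμG hμT

/-- **Lebowitz 1977, Thm. 3 with Remark (i), proved: off a countable set of inverse temperatures,
all translation invariant Gibbs states of the zero-field nearest-neighbour Ising model on `ℤ^d`,
`d ≥ 2`, above `β_c(d)` are mixtures of `μ⁺` and `μ⁻`** ("the set of values of `β` at which there
are more than two extremal translation invariant equilibrium states … has zero Lebesgue measure";
Remark (i): it is at most countable, being contained in the discontinuity set of the monotone
energy `β ↦ ∑ᵢ ⟨σ_0σ_{eᵢ}⟩⁺_β`, Mathlib's `Monotone.countable_not_continuousAt`). [cite: Lebowitz1977, §3, Thm. 3 and Remark (i), pp. 471–472] -/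
theorem countable_setOf_not_translationInvariant_eq_mixture (hd : 2 ≤ d) :
    ∃ S : Set ℝ, S.Countable ∧ ∀ β : ℝ, criticalBeta d < β → β ∉ S →
      ∀ μ ∈ isingGibbsMeasures d β 0, IsTranslationInvariantMeasure μ →
        ∃ μp μm : Measure (SpinConfig (Site d)),
          μp ∈ isingGibbsMeasures d β 0 ∧ μm ∈ isingGibbsMeasures d β 0 ∧
            (∀ A, spinCorr μp A = plusCorr d β 0 A) ∧ (∀ A, spinCorr μm A = minusCorr d β 0 A) ∧
              ∃ t : ℝ≥0∞, t ≤ 1 ∧ μ = t • μp + (1 - t) • μm := by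
  set Pt : ℝ → ℝ := fun b => ∑ i : Fin d, plusCorr d (max b 0) 0 {0, Pi.single i 1} with hPt
  have hmono : Monotone Pt := by
    intro a b hab
    simp only [hPt]
    exact Finset.sum_le_sum fun i _ =>
      plusCorr_mono_params (le_max_right a 0) (max_le_max hab le_rfl) le_rfl le_rfl _
  refine ⟨{x | ¬ContinuousAt Pt x}, hmono.countable_not_continuousAt, ?_⟩
  intro β hβc hβS μ hμG hμT
  have hcont : ContinuousAt Pt β := not_not.1 hβS
  exact translationInvariant_eq_mixture_of_continuousAt hd hβc hcont hμG hμT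

end Literature.Probability.LatticeModels
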